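import Mathlib.FieldTheory.KummerPolynomial
import Mathlib.FieldTheory.IntermediateField.Adjoin.Basic
import Mathlib.RingTheory.RootsOfUnity.PrimitiveRoots
import HarnessLib

/-!
# Kummer theory for cube roots: the cubes of `K(∛b)` that lie in `K` are `K³ · b^{0,1,2}`
# (`K ∋ ζ₃`)

Topic `NumberTheory/EllipticCurves` (arithmetic inputs of the `2`-adic CM-frame Kolyvagin argument on
crux `UpperOffV0HSYPlus`; the instance for Hu–Shu–Yin's pair `(E_p, E_{3p²})` is
`HuShuYin2019/SylvesterPairKummerIndependence.lean`), namespace `Literature.NumberTheory.EllipticCurves.Kummer`.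
THEOREMS ONLY (no definition, no named fact, no instance, no notation; D-0014/D-0026). Cell `bsd-cm`, row
`bsd-cm-k-ty1`, fourth seating (planner D418: «Kummer independence over `K⟮θ⟯`» = this lane);
`--supports stmt-BirchSwinnertonDyer-19804`.

**`Kummer.exists_eq_pow_three_mul_pow`** (Kummer theory for the exponent `3`, the "injectivity" half of
the Kummer correspondence; Lang, *Algebra*, VI §8 Thms. 8.1–8.2 / Childress, *Class Field Theory*, Ch. 6 §2
Thm. 2.1: for `F ∋ μ_n` the Kummer `n`-extensions `F(W^{1/n})` correspond bijectively to the subgroups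
`F^{×n} ⊆ W ⊆ F^×`, so the `n`-th powers of `F(ⁿ√b)^×` lying in `F^×` form `F^{×n}·b^ℤ`): let `K` be a field containing a primitive cube
root of unity `ζ`, `E/K` any extension, `θ ∈ E` with `θ³ = b ∈ K`, and `t ∈ K⟮θ⟯` with `t³ = a ∈ K`. Then
`a = c³ · b^j` for some `c ∈ K` and `j ∈ {0, 1, 2}`.

PROOF (eigenvectors of the Kummer automorphism). If `θ ∈ K` then `K⟮θ⟯ = K` and `a = t³`, `t ∈ K`. Otherwise
`b` is not a cube in `K` (a cube root `r ∈ K` of `b` would give `θ = ζ^i r ∈ K`), so `X³ − b` is irreducible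
(Mathlib `X_pow_sub_C_irreducible_iff_of_prime`), `1, θ, θ²` is a `K`-basis of `K⟮θ⟯`
(`IntermediateField.adjoin.powerBasis`), and `θ ↦ ζθ` extends to a `K`-algebra endomorphism `σ` of `K⟮θ⟯`
(`PowerBasis.lift`). From `σ(t)³ = σ(a) = a = t³` we get `σ t = ζ^k t` for some `k` (the cube roots of
`1` in the field `K⟮θ⟯` are the `ζ^i`); writing `t = c₀ + c₁θ + c₂θ²` and comparing coefficients of
`σ t = c₀ + ζc₁θ + ζ²c₂θ²` with `ζ^k t` kills `c_i` for `i ≠ k`, so `t = c_k θ^k` and `a = c_k³ b^k`.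

HONEST FRAMING: field theory only; nothing about elliptic curves, Selmer groups or BSD is asserted.

## References

* S. Lang, *Algebra*, rev. 3rd ed., GTM 211 (2002), VI §8, Thms. 8.1–8.2 (Kummer theory). [Lang2002]
* N. Childress, *Class Field Theory*, Universitext (2009), Ch. 6 §2, Thm. 2.1 (Kummer `n`-extensions
  `F(W^{1/n}) ↔ W`, `F^{×n} ⊆ W ⊆ F^×`; held `book:childress2009-class-field-theory`, PDF p0142). [Childress2009]

## Mathlib / tree search
Mathlib: `X_pow_sub_C_irreducible_iff_of_prime` (`FieldTheory/KummerPolynomial`), `IntermediateField.adjoin.powerBasis`,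
`PowerBasis.lift`, `Basis.repr_sum_self`, `IsPrimitiveRoot.eq_pow_of_pow_eq_one`, `IsPrimitiveRoot.pow_inj`;
`FieldTheory/KummerExtension.lean` has the Galois group of `K(ⁿ√a)` (`autEquivZmod`) but not this
classification of `n`-th powers. `lean search 'Kummer'` in the project: no cube-root independence lemma.
presearch: «Kummer n-extensions correspond to subgroups W ⊇ F^{×n}» → [corpus:book:childress2009-class-field-theory p0142]
(Thm. 2.1, proof via σ(α) = ζα — the argument formalised here for n = 3 and W = ⟨b⟩F^{×3}).
-/

noncomputable section

open Polynomial IntermediateField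

namespace Literature.NumberTheory.EllipticCurves.Kummer

variable {K E : Type*} [Field K] [Field E] [Algebra K E]

/-- The cube roots of `1` in a field containing a primitive cube root of unity `ζ` are `1, ζ, ζ²`: if
`u³ = v³` with `v ≠ 0` then `u = ζ^i v` for some `i < 3`. [cite: Lang2002, VI §8 (proof of Thm. 8.1)] -/
theorem exists_eq_pow_mul_of_pow_three_eq {F : Type*} [Field F] {ζ : F} (hζ : IsPrimitiveRoot ζ 3)
    {u v : F} (hv : v ≠ 0) (h : u ^ 3 = v ^ 3) : ∃ i < 3, u = ζ ^ i * v := by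
  have h1 : (u / v) ^ 3 = 1 := by rw [div_pow, h, div_self (pow_ne_zero _ hv)]
  obtain ⟨i, hi, hζi⟩ := hζ.eq_pow_of_pow_eq_one h1
  exact ⟨i, hi, by rw [hζi, div_mul_cancel₀ u hv]⟩

/-- If `θ ∈ E` has `θ³ = b ∈ K` and `θ ∉ K` (i.e. `θ` is not in the bottom field), and `K` contains a
primitive cube root of unity, then `X³ − b` is irreducible over `K` (a root `r ∈ K` would give
`θ = ζ^i r ∈ K`). [cite: Lang2002, VI §9 Thm. 9.1 and §8] -/
theorem irreducible_X_pow_three_sub_C {ζ : K} (hζ : IsPrimitiveRoot ζ 3) {θ : E} {b : K}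
    (hθ : θ ^ 3 = algebraMap K E b) (hθK : θ ∉ (⊥ : IntermediateField K E)) :
    Irreducible (X ^ 3 - C b) := by
  rw [X_pow_sub_C_irreducible_iff_of_prime Nat.prime_three]
  intro r hr
  apply hθK
  have hζE : IsPrimitiveRoot (algebraMap K E ζ) 3 := hζ.map_of_injective (algebraMap K E).injective
  by_cases hr0 : r = 0
  · subst hr0
    have hb : b = 0 := by rw [← hr]; ring
    have hθ0 : θ = 0 := by
      have : θ ^ 3 = 0 := by rw [hθ, hb, map_zero]
      exact pow_eq_zero_iff (n := 3) (by norm_num) |>.mp this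
    rw [hθ0]; exact zero_mem _
  have hrE : algebraMap K E r ≠ 0 := (_root_.map_ne_zero _).mpr hr0
  obtain ⟨i, -, hi⟩ := exists_eq_pow_mul_of_pow_three_eq hζE hrE
    (by rw [hθ, ← map_pow, hr] : θ ^ 3 = algebraMap K E r ^ 3)
  rw [hi, ← map_pow, ← map_mul]
  exact IntermediateField.algebraMap_mem ⊥ _

/-- **Kummer theory for cube roots.** Let `K` be a field containing a primitive cube root of unity `ζ`,
`E/K` an extension, `θ ∈ E` with `θ³ = b ∈ K`, and `t ∈ K⟮θ⟯` with `t³ = a ∈ K`. Then `a = c³ · b^j` for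
some `c ∈ K` and `j < 3`: the cubes of `K(∛b)^×` lying in `K` are exactly `K^{×3} · b^ℤ` (Kummer pairing,
exponent `3`). Equivalently: if `a ∉ K³ ∪ K³b ∪ K³b²` then `X³ − a` has no root in `K(∛b)`.
[cite: Lang2002, VI §8 Thms. 8.1–8.2] [cite: Childress2009, Ch. 6 §2 Thm. 2.1] -/
theorem exists_eq_pow_three_mul_pow {ζ : K} (hζ : IsPrimitiveRoot ζ 3) {θ : E} {b : K}
    (hθ : θ ^ 3 = algebraMap K E b) {t : E} (ht : t ∈ K⟮θ⟯) {a : K}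
    (hta : t ^ 3 = algebraMap K E a) :
    ∃ (c : K) (j : ℕ), j < 3 ∧ a = c ^ 3 * b ^ j := by
  classical
  -- Case `θ ∈ K`: then `K⟮θ⟯ = K` and `t ∈ K`.
  by_cases hθK : θ ∈ (⊥ : IntermediateField K E)
  · have hbot : K⟮θ⟯ = ⊥ := IntermediateField.adjoin_simple_eq_bot_iff.mpr hθK
    rw [hbot, IntermediateField.mem_bot] at ht
    obtain ⟨c, rfl⟩ := ht
    refine ⟨c, 0, by norm_num, ?_⟩
    rw [pow_zero, mul_one]
    exact (algebraMap K E).injective (by rw [map_pow, hta])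
  -- Case `θ ∉ K`: `X³ − b` is irreducible, `[K⟮θ⟯ : K] = 3` with power basis `1, θ, θ²`.
  have hirr : Irreducible (X ^ 3 - C b) := irreducible_X_pow_three_sub_C hζ hθ hθK
  have hmonic : (X ^ 3 - C b : K[X]).Monic := monic_X_pow_sub_C b three_ne_zero
  have hθint : IsIntegral K θ := ⟨X ^ 3 - C b, hmonic, by simp [hθ]⟩
  have hmin : minpoly K θ = X ^ 3 - C b :=
    (minpoly.eq_of_irreducible_of_monic hirr (by simp [hθ]) hmonic).symm
  set pb := IntermediateField.adjoin.powerBasis hθint with hpb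
  have hdim : pb.dim = 3 := by
    rw [hpb, IntermediateField.adjoin.powerBasis_dim, hmin, natDegree_X_pow_sub_C]
  have hgen : ((pb.gen : K⟮θ⟯) : E) = θ := by
    rw [hpb, IntermediateField.adjoin.powerBasis_gen, IntermediateField.AdjoinSimple.coe_gen]
  -- the Kummer endomorphism `σ : θ ↦ ζθ`
  set ζ' : K⟮θ⟯ := algebraMap K K⟮θ⟯ ζ with hζ'
  have hζ'3 : ζ' ^ 3 = 1 := by rw [hζ', ← map_pow, hζ.pow_eq_one, map_one]
  have hgen3 : pb.gen ^ 3 = algebraMap K K⟮θ⟯ b := by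
    apply Subtype.ext
    rw [SubmonoidClass.coe_pow, hgen, hθ]
    rfl
  have hy : aeval (ζ' * pb.gen) (minpoly K pb.gen) = 0 := by
    rw [hpb, IntermediateField.adjoin.powerBasis_gen, IntermediateField.minpoly_gen, hmin]
    simp only [map_sub, map_pow, aeval_X, aeval_C]
    rw [mul_pow, hζ'3, one_mul, ← IntermediateField.adjoin.powerBasis_gen hθint, ← hpb, hgen3, sub_self]
  set σ : K⟮θ⟯ →ₐ[K] K⟮θ⟯ := pb.lift (ζ' * pb.gen) hy with hσ
  have hσgen : σ pb.gen = ζ' * pb.gen := pb.lift_gen _ hy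
  have hσpow : ∀ i : ℕ, σ (pb.gen ^ i) = ζ' ^ i * pb.gen ^ i := fun i ↦ by
    rw [map_pow, hσgen, mul_pow]
  -- `t` as an element of `K⟮θ⟯`, its coordinates `c`, and `σ t = ζ^k t`
  set t' : K⟮θ⟯ := ⟨t, ht⟩ with ht'
  have ht'3 : t' ^ 3 = algebraMap K K⟮θ⟯ a := by
    apply Subtype.ext
    rw [SubmonoidClass.coe_pow]
    exact hta
  set c : Fin pb.dim → K := fun i ↦ pb.basis.repr t' i with hc
  have ht'sum : t' = ∑ i, c i • pb.gen ^ (i : ℕ) := by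
    conv_lhs => rw [← pb.basis.sum_repr t']
    simp only [hc, pb.coe_basis]
  have hσt3 : (σ t') ^ 3 = t' ^ 3 := by rw [← map_pow, ht'3, AlgHom.commutes]
  -- `σ t' = ζ'^k • t'`
  have hζK : IsPrimitiveRoot ζ' 3 := hζ.map_of_injective (algebraMap K K⟮θ⟯).injective
  obtain ⟨k, hk, hσt⟩ : ∃ k < 3, σ t' = ζ' ^ k * t' := by
    by_cases ht0 : t' = 0
    · exact ⟨0, by norm_num, by rw [ht0, map_zero, mul_zero]⟩
    · exact exists_eq_pow_mul_of_pow_three_eq hζK ht0 hσt3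
  -- compare coordinates: `c i * ζ^i = ζ^k * c i`
  have hcoord : ∀ i : Fin pb.dim, c i * ζ ^ (i : ℕ) = ζ ^ k * c i := by
    have h1 : σ t' = ∑ i, (c i * ζ ^ (i : ℕ)) • pb.basis i := by
      rw [ht'sum, map_sum]
      refine Finset.sum_congr rfl fun i _ ↦ ?_
      rw [map_smul, hσpow, pb.coe_basis, mul_smul, Algebra.smul_def (ζ ^ (i : ℕ)), map_pow]
    have h2 : σ t' = ∑ i, (ζ ^ k * c i) • pb.basis i := by
      rw [hσt, ht'sum, Finset.mul_sum]
      refine Finset.sum_congr rfl fun i _ ↦ ?_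
      rw [pb.coe_basis, mul_smul, Algebra.smul_def (ζ ^ k), map_pow]
    intro i
    have e1 := congrArg (fun v ↦ pb.basis.repr v i) h1
    have e2 := congrArg (fun v ↦ pb.basis.repr v i) h2
    simp only [pb.basis.repr_sum_self] at e1 e2
    rw [← e1, ← e2]
  -- hence `c i = 0` for `i ≠ k`
  have hczero : ∀ i : Fin pb.dim, (i : ℕ) ≠ k → c i = 0 := by
    intro i hik
    have hne : ζ ^ (i : ℕ) ≠ ζ ^ k := by
      intro h
      have hi3 : (i : ℕ) < 3 := by have := i.2; omega
      exact hik (hζ.pow_inj hi3 hk h)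
    have h := hcoord i
    have : c i * (ζ ^ (i : ℕ) - ζ ^ k) = 0 := by rw [mul_sub, h]; ring
    rcases mul_eq_zero.mp this with h0 | h0
    · exact h0
    · exact absurd (sub_eq_zero.mp h0) hne
  -- so `t' = c_k • θ^k`
  set kk : Fin pb.dim := ⟨k, by rw [hdim]; exact hk⟩ with hkk
  have ht'eq : t' = c kk • pb.gen ^ k := by
    rw [ht'sum, Finset.sum_eq_single kk]
    · intro i _ hik
      rw [hczero i (fun h ↦ hik (Fin.ext h)), zero_smul]
    · intro h; exact absurd (Finset.mem_univ kk) h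
  refine ⟨c kk, k, hk, ?_⟩
  apply (algebraMap K K⟮θ⟯).injective
  rw [← ht'3, ht'eq, _root_.smul_pow, ← pow_mul, mul_comm k 3, pow_mul, hgen3, Algebra.smul_def, map_mul,
    map_pow, map_pow]

/-- **Contrapositive form (the shape used by the Čebotarev input (Z) of the CM-frame argument).** With
`K ∋ ζ` a primitive cube root of unity, `θ³ = b ∈ K`, `a ∈ K`: if `a ≠ c³ b^j` for all `c ∈ K`, `j < 3`,
then `t³ ≠ a` for every `t ∈ K⟮θ⟯` — `X³ − a` has no root in `K(∛b)`.
[cite: Lang2002, VI §8 Thms. 8.1–8.2] [cite: Childress2009, Ch. 6 §2 Thm. 2.1] -/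
theorem pow_three_ne_of_forall {ζ : K} (hζ : IsPrimitiveRoot ζ 3) {θ : E} {b : K}
    (hθ : θ ^ 3 = algebraMap K E b) {a : K} (ha : ∀ (c : K) (j : ℕ), j < 3 → a ≠ c ^ 3 * b ^ j)
    {t : E} (ht : t ∈ K⟮θ⟯) : t ^ 3 ≠ algebraMap K E a := by
  intro hta
  obtain ⟨c, j, hj, h⟩ := exists_eq_pow_three_mul_pow hζ hθ ht hta
  exact ha c j hj h

end Literature.NumberTheory.EllipticCurves.Kummer
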